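import Literature.NumberTheory.Transcendental.LindemannWeierstrassMeasureHolds
import Literature.NumberTheory.Transcendental.AxSchanuelUniv
import Summits.Schanuel.Schanuel.Theorems.RootDecomp1BMovingZero22
import Summits.Schanuel.Schanuel.Theorems.RootDecomp1BRadicalDescent06
import Summits.Schanuel.Schanuel.Theorems.RootDecomp1BSRLLogLiouville02

/-!
# RootDecomp1BFactDischarge — lens 4, generation 40 ADDENDUM «TWO NAMED INPUTS DISCHARGED BY NAME» (RULE B-R26 lane (a″)): `lwMeasure_holds : LWMeasure` (:= Literature `Ably1994_lindemannWeierstrass_measure_holds`) and `axRankBoundLaurent_holds : AxRankBoundLaurent` (Ax 1971 at (ℂ, ℂ⸨X⸩, 1)) now that the farm builds the two Literature cones; the B-side cells re-issued WITHOUT those binders — `movingZeroApprox_holds : ∀ ρ, MovingZeroApprox ρ` UNCONDITIONAL, the (1|ρ) moving-zero cells mod `ExplicitRatExpApprox` ONLY, the ultra-Liouville storey-two cells and the SRL log-Liouville cells UNCONDITIONAL — part 1 (RootDecomp1BFactDischarge01): the two discharges + the re-issued B-side cells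

(lens-4 g40 HOME file FactDischarge.lean e35e20f8…, 256 l, imports Literature LindemannWeierstrassMeasureHolds + AxSchanuelUniv + tree MovingZero22 / RadicalDescent06 / SRLLogLiouville02; NODE L2101 §7 / REQUEST L2102 / RESULT L2103; critic VERDICT L2111 (B) (crit g9: BOOKKEEPING, credit ×0, BOOKED OF RECORD — inputs of record of the moving-zero cell shrink to {ExplicitRatExpApprox}; PORT GO as ONE file `--supports stmt-Schanuel-24622`); port by census-1 gen 18 as ONE file. PORT EDITS: the axiom-guard section (7 `#guard_msgs in #print axioms`) and `set_option linter.dupNamespace false` dropped; three one-line docstrings added; statements and proofs verbatim. `--supports stmt-Schanuel-24622`; no census credit carried; rung 0 — nothing here proves Schanuel.)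
-/

/-!
# RootDecomp1B — lens 4, generation 40, ADDENDUM «TWO NAMED INPUTS DISCHARGED BY NAME» (RULE B-R26 lane (a″))

The two registered, tree-PROVED inputs that every B-side cell so far carried AS BINDERS because their
Literature modules were `stale/unbuilt` on the farm —

* `RootDecomp1KHyper.LWMeasure` (KHyper04 l.154: verbatim copy of the named fact
  `Literature.NumberTheory.Transcendental.Ably1994_lindemannWeierstrass_measure`, Ably, Acta Arith. 67 (1994),
  Théorème p. 30), PROVED as `Ably1994_lindemannWeierstrass_measure_holds` (`LindemannWeierstrassMeasureHolds.lean`);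
* `RootDecomp1BMovingZero.AxRankBoundLaurent` (MovingZero08 l.95: the tree theorem
  `Ax1971.add_rank_le_trdeg_of_field` at `(k, K, m) = (ℂ, ℂ⸨X⸩, 1)`, `AxSchanuelUniv.lean`)

— are discharged here BY NAME, in one line each (both cones elaborate on the farm as of 2026-08-31T16:12Z:
smoke files `Smoke1.lean` / `Smoke3.lean`, `lean check` rc 0), and the B-side cells that consumed them are
re-issued with those binders REMOVED.  What remains conditional is conditional on `ExplicitRatExpApprox` ONLY
(its module `ExpAlgebraicTranscendenceMeasureProofs` is still rc 75 `unavailable` on the farm).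

HEADLINES (hypothesis-free unless marked `hX`):
* `dense_storey_two_cells : Dense {ρ : ℝ | ((2+2 : ℕ) : Cardinal) ≤ polarDeg ![1, ρ]}` and
  `exists_storey_two_cell`, `storey_two_cell_rhoU` — X(2) at `(1 | ρ)` UNCONDITIONALLY for every ultra-Liouville
  `ρ` and at the named `ρ_U` (lens-4 g33 RadicalDescent cells, formerly mod `hLW`);
* `movingZeroApprox_holds : ∀ ρ, MovingZeroApprox ρ` UNCONDITIONAL (lens-4 g35–g39 moving-zero chain, formerly
  mod `hAx`); the moving-zero cells `four_le_polarDeg_one_of_liouvilleOrder_eight (hX)`,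
  `four_le_polarDeg_one_hyper (hX)`, `four_le_polarDeg_one_rhoT (hX)` now mod `ExplicitRatExpApprox` ONLY;
* the SRL log-Liouville cells (`cell_one_log_lambdaH`, `cell_one_sqrt_two_log_lambdaH`,
  `cell_one_arctan_liouvilleNumber_ten`, `cell_sqrt_two_liouvilleNumber_ten`, …) UNCONDITIONAL.

No new mathematics: every proof is the tree theorem applied to the two discharges.  No credit is asked beyond
lane (a″)'s «THEOREM per by-name discharge»; the point is that the farm now CHECKS these cones, so the census can
port the discharges and drop the binders tree-wide (1E `schanuel_on_lwClass`, 1K `sb_three_z8`, … take `hLW` too —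
listed in NODE.md §7, not re-issued here to keep this file on 1B).
-/

noncomputable section

namespace Summit.Schanuel.Schanuel.Theorems.RootDecomp1BFactDischarge

open Complex
open Summit.Schanuel.Schanuel.Theorems.RootDecomp1KHyper (LWMeasure)
open Summit.Schanuel.Schanuel.Theorems.RootDecomp1KHyper.HyperCell (HyperLiouville ExplicitRatExpApprox lambdaH)
open Summit.Schanuel.Schanuel.Theorems.RootDecomp1KGeneric (LiouvilleOrder)
open Summit.Schanuel.Schanuel.Theorems.RootDecomp1KFiniteOrderCell (towerNumber)
open Summit.Schanuel.Schanuel.Theorems.RootDecomp1BFedFlagCore (polarDeg)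
open Summit.Schanuel.Schanuel.Theorems.RootDecomp1BDefectFloorDefs (SharpRelativeLindemannAt TameDefectZeroAt
  WildSharpDefectZeroAt WildSharpDefectZeroInitAt)
open Summit.Schanuel.Schanuel.Theorems.RootDecomp1BMovingZero (AxRankBoundLaurent MovingZeroApprox
  movingZeroApprox_of_ax four_le_polarDeg_one_of_ax four_le_polarDeg_swap_of_ax four_le_polarDeg_one_hyper_of_ax
  four_le_polarDeg_one_rhoT_of_ax)
open Summit.Schanuel.Schanuel.Theorems.RootDecomp1BRadicalDescent (UltraLiouville rhoU)

/-! ## §1 The two discharges -/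

/-- **`LWMeasure` HOLDS** — it is, character for character, the Literature named fact
`Ably1994_lindemannWeierstrass_measure`, proved in the tree as `Ably1994_lindemannWeierstrass_measure_holds`
[cite: Ably1994, Théorème p. 30]. -/
theorem lwMeasure_holds : LWMeasure :=
  Literature.NumberTheory.Transcendental.Ably1994_lindemannWeierstrass_measure_holds

/-- **`AxRankBoundLaurent` HOLDS** — it is `Ax1971.add_rank_le_trdeg_of_field` with `k = ℂ`, `K = ℂ⸨X⸩`, `m = 1`
[cite: Ax1971, Thm. 3]. (The lens-4 g35 HOME file `MovingZeroAxGermsTree.lean` verbatim, now farm-checkable.) -/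
theorem axRankBoundLaurent_holds : AxRankBoundLaurent := by
  intro _n Dv hC y z hz hexp hind
  haveI : CharZero (LaurentSeries ℂ) :=
    charZero_of_injective_algebraMap (algebraMap ℂ (LaurentSeries ℂ)).injective
  exact Literature.NumberTheory.Transcendental.Ax1971.add_rank_le_trdeg_of_field Dv hC y z hz hexp hind

/-! ## §2 The moving-zero chain (lens-4 g35–g39): `MovingZeroApprox ρ` for EVERY real `ρ`, UNCONDITIONAL;
the X(2) cells of the `LiouvilleOrder 8` class mod `ExplicitRatExpApprox` ONLY -/

/-- **`MovingZeroApprox ρ` for every real `ρ` — UNCONDITIONAL** (MovingZero22 `movingZeroApprox_of_ax` with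
`hAx` discharged). -/
theorem movingZeroApprox_holds (ρ : ℝ) : MovingZeroApprox ρ :=
  movingZeroApprox_of_ax axRankBoundLaurent_holds ρ

/-- **X(2) at `(1, ρ)` for every real `ρ` of exponential Liouville order `8`, mod `ExplicitRatExpApprox` ONLY.** -/
theorem four_le_polarDeg_one_of_liouvilleOrder_eight (hX : ExplicitRatExpApprox) {ρ : ℝ}
    (hρ : LiouvilleOrder 8 ρ) : ((2 + 2 : ℕ) : Cardinal) ≤ polarDeg ![(1 : ℝ), ρ] :=
  four_le_polarDeg_one_of_ax lwMeasure_holds hX axRankBoundLaurent_holds hρ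

/-- … the swapped cell `(ρ, 1)`. -/
theorem four_le_polarDeg_swap_of_liouvilleOrder_eight (hX : ExplicitRatExpApprox) {ρ : ℝ}
    (hρ : LiouvilleOrder 8 ρ) : ((2 + 2 : ℕ) : Cardinal) ≤ polarDeg ![ρ, (1 : ℝ)] :=
  four_le_polarDeg_swap_of_ax lwMeasure_holds hX axRankBoundLaurent_holds hρ

/-- … the hyper-Liouville class (1K item 33363's class), mod `ExplicitRatExpApprox` ONLY. -/
theorem four_le_polarDeg_one_hyper (hX : ExplicitRatExpApprox) {ρ : ℝ} (hρ : HyperLiouville ρ) :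
    ((2 + 2 : ℕ) : Cardinal) ≤ polarDeg ![(1 : ℝ), ρ] :=
  four_le_polarDeg_one_hyper_of_ax lwMeasure_holds hX axRankBoundLaurent_holds hρ

/-- … the NAMED member `ρ_T = towerNumber 9` (not hyper-Liouville), mod `ExplicitRatExpApprox` ONLY. -/
theorem four_le_polarDeg_one_rhoT (hX : ExplicitRatExpApprox) :
    ((2 + 2 : ℕ) : Cardinal) ≤ polarDeg ![(1 : ℝ), towerNumber 9] :=
  four_le_polarDeg_one_rhoT_of_ax lwMeasure_holds hX axRankBoundLaurent_holds

/-! ## §3 The ultra-Liouville cells (lens-4 g33, RadicalDescent05/06) — UNCONDITIONAL -/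

/-- **X(2)(1, ρ): `t(1, ρ) ≥ 4`** for EVERY ultra-Liouville `ρ` — UNCONDITIONAL. -/
theorem four_le_polarDeg_one_ultra {ρ : ℝ} (hρ : UltraLiouville ρ) :
    ((2 + 2 : ℕ) : Cardinal) ≤ polarDeg ![(1 : ℝ), ρ] :=
  RootDecomp1BRadicalDescent.four_le_polarDeg_one_ultra lwMeasure_holds hρ

/-- The same in the VERBATIM shape of the body of the 1B crux `KleinPolarSchanuel` at `m = 2`, `r = (1, ρ)`. -/
theorem kleinPolarSchanuel_body_two_one_ultra {ρ : ℝ} (hρ : UltraLiouville ρ) :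
    ((2 + 2 : ℕ) : Cardinal) ≤ Algebra.trdeg ℚ ↥(IntermediateField.adjoin ℚ
      (Set.range (Fin.append (fun j => ((![(1 : ℝ), ρ] j : ℝ) : ℂ)) (fun j => ((![(1 : ℝ), ρ] j : ℝ) : ℂ) * Complex.I)) ∪
        Set.range (Complex.exp ∘ Fin.append (fun j => ((![(1 : ℝ), ρ] j : ℝ) : ℂ))
          (fun j => ((![(1 : ℝ), ρ] j : ℝ) : ℂ) * Complex.I)))) :=
  RootDecomp1BRadicalDescent.kleinPolarSchanuel_body_two_one_ultra lwMeasure_holds hρ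

/-- **SRLAt (1 | ρ)**, `ρ` ultra-Liouville — UNCONDITIONAL. -/
theorem sharpRelativeLindemannAt_one_ultra {ρ : ℝ} (hρ : UltraLiouville ρ) :
    SharpRelativeLindemannAt 1 ![(1 : ℝ), ρ] :=
  RootDecomp1BRadicalDescent.sharpRelativeLindemannAt_one_ultra lwMeasure_holds hρ

/-- **T0At (1 | ρ)** — UNCONDITIONAL. -/
theorem tameDefectZeroAt_one_ultra {ρ : ℝ} (hρ : UltraLiouville ρ) : TameDefectZeroAt 1 ![(1 : ℝ), ρ] :=
  RootDecomp1BRadicalDescent.tameDefectZeroAt_one_ultra lwMeasure_holds hρ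

/-- **W0At (1 | ρ)** — UNCONDITIONAL. -/
theorem wildSharpDefectZeroAt_one_ultra {ρ : ℝ} (hρ : UltraLiouville ρ) :
    WildSharpDefectZeroAt 1 ![(1 : ℝ), ρ] :=
  RootDecomp1BRadicalDescent.wildSharpDefectZeroAt_one_ultra lwMeasure_holds hρ

/-- **W0InitAt (1 | ρ)** — UNCONDITIONAL. -/
theorem wildSharpDefectZeroInitAt_one_ultra {ρ : ℝ} (hρ : UltraLiouville ρ) :
    WildSharpDefectZeroInitAt 1 ![(1 : ℝ), ρ] :=
  RootDecomp1BRadicalDescent.wildSharpDefectZeroInitAt_one_ultra lwMeasure_holds hρ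

/-- **FLAGSHIP — UNCONDITIONAL.** There is a real `ρ > 0`, irrational, `(1, ρ)` `ℚ`-free, with `t(1, ρ) ≥ 4`. -/
theorem exists_storey_two_cell :
    ∃ ρ : ℝ, 0 < ρ ∧ Irrational ρ ∧ LinearIndependent ℚ ![(1 : ℝ), ρ] ∧
      ((2 + 2 : ℕ) : Cardinal) ≤ polarDeg ![(1 : ℝ), ρ] :=
  RootDecomp1BRadicalDescent.exists_storey_two_cell lwMeasure_holds

/-- **… and such `ρ` are DENSE in `ℝ` — UNCONDITIONAL.** -/
theorem dense_storey_two_cells :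
    Dense {ρ : ℝ | ((2 + 2 : ℕ) : Cardinal) ≤ polarDeg ![(1 : ℝ), ρ]} :=
  RootDecomp1BRadicalDescent.dense_storey_two_cells lwMeasure_holds

/-- **X(2)(1, ρ_U)** at the NAMED member `ρ_U` — UNCONDITIONAL. -/
theorem four_le_polarDeg_one_rhoU : ((2 + 2 : ℕ) : Cardinal) ≤ polarDeg ![(1 : ℝ), rhoU] :=
  RootDecomp1BRadicalDescent.four_le_polarDeg_one_rhoU lwMeasure_holds

/-- The At-cells at `(1 | ρ_U)` — UNCONDITIONAL. -/
theorem sharpRelativeLindemannAt_one_rhoU : SharpRelativeLindemannAt 1 ![(1 : ℝ), rhoU] :=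
  RootDecomp1BRadicalDescent.sharpRelativeLindemannAt_one_rhoU lwMeasure_holds

/-- The tame defect-zero cell at `(1 | ρ_U)`, unconditional. -/
theorem tameDefectZeroAt_one_rhoU : TameDefectZeroAt 1 ![(1 : ℝ), rhoU] :=
  RootDecomp1BRadicalDescent.tameDefectZeroAt_one_rhoU lwMeasure_holds

/-- The wild sharp defect-zero cell at `(1 | ρ_U)`, unconditional. -/
theorem wildSharpDefectZeroAt_one_rhoU : WildSharpDefectZeroAt 1 ![(1 : ℝ), rhoU] :=
  RootDecomp1BRadicalDescent.wildSharpDefectZeroAt_one_rhoU lwMeasure_holds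

/-- The wild sharp defect-zero initial cell at `(1 | ρ_U)`, unconditional. -/
theorem wildSharpDefectZeroInitAt_one_rhoU : WildSharpDefectZeroInitAt 1 ![(1 : ℝ), rhoU] :=
  RootDecomp1BRadicalDescent.wildSharpDefectZeroInitAt_one_rhoU lwMeasure_holds

/-- **EXPLICIT STOREY-TWO CELL — UNCONDITIONAL**: `ρ_U > 0`, irrational, `(1, ρ_U)` `ℚ`-free, `t(1, ρ_U) ≥ 4`. -/
theorem storey_two_cell_rhoU :
    0 < rhoU ∧ Irrational rhoU ∧ LinearIndependent ℚ ![(1 : ℝ), rhoU] ∧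
      ((2 + 2 : ℕ) : Cardinal) ≤ polarDeg ![(1 : ℝ), rhoU] :=
  RootDecomp1BRadicalDescent.storey_two_cell_rhoU lwMeasure_holds

/-! ## §4 The SRL log-Liouville / arctan / coordinate-column cells (SRLLogLiouville02) — UNCONDITIONAL -/

/-- `log λ_H` is transcendental — UNCONDITIONAL. -/
theorem transcendental_log_lambdaH : Transcendental ℚ ((Real.log lambdaH : ℝ) : ℂ) :=
  RootDecomp1BSRLLogLiouville.transcendental_log_lambdaH lwMeasure_holds

/-- `log L₁₀` is transcendental — UNCONDITIONAL. -/
theorem transcendental_log_liouvilleNumber_ten : Transcendental ℚ ((Real.log (liouvilleNumber 10) : ℝ) : ℂ) :=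
  RootDecomp1BSRLLogLiouville.transcendental_log_liouvilleNumber_ten lwMeasure_holds

/-- `(1 | log λ_H)`: ℚ-free, `t ≥ 3`, SRLAt — UNCONDITIONAL. -/
theorem cell_one_log_lambdaH :
    LinearIndependent ℚ (Fin.snoc ![(1 : ℝ)] (Real.log lambdaH) : Fin 2 → ℝ) ∧
      polarDeg (Fin.init (Fin.snoc ![(1 : ℝ)] (Real.log lambdaH) : Fin 2 → ℝ)) ≤ ((1 + 1 : ℕ) : Cardinal) ∧
      ((1 + 1 + 1 : ℕ) : Cardinal) ≤ polarDeg (Fin.snoc ![(1 : ℝ)] (Real.log lambdaH) : Fin 2 → ℝ) ∧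
      SharpRelativeLindemannAt 1 (Fin.snoc ![(1 : ℝ)] (Real.log lambdaH) : Fin 2 → ℝ) :=
  RootDecomp1BSRLLogLiouville.cell_one_log_lambdaH lwMeasure_holds

/-- `(1, √2 | log λ_H)` at storey 3: `t ≥ 5`, SRLAt 2 — UNCONDITIONAL. -/
theorem cell_one_sqrt_two_log_lambdaH :
    LinearIndependent ℚ (Fin.snoc ![(1 : ℝ), Real.sqrt 2] (Real.log lambdaH) : Fin 3 → ℝ) ∧
      polarDeg (Fin.init (Fin.snoc ![(1 : ℝ), Real.sqrt 2] (Real.log lambdaH) : Fin 3 → ℝ)) ≤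
        ((2 + 2 : ℕ) : Cardinal) ∧
      ((2 + 2 + 1 : ℕ) : Cardinal) ≤ polarDeg (Fin.snoc ![(1 : ℝ), Real.sqrt 2] (Real.log lambdaH) : Fin 3 → ℝ) ∧
      SharpRelativeLindemannAt 2 (Fin.snoc ![(1 : ℝ), Real.sqrt 2] (Real.log lambdaH) : Fin 3 → ℝ) :=
  RootDecomp1BSRLLogLiouville.cell_one_sqrt_two_log_lambdaH lwMeasure_holds

/-- `(1 | arctan L₁₀)`: `t ≥ 3`, SRLAt — UNCONDITIONAL. -/
theorem cell_one_arctan_liouvilleNumber_ten :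
    LinearIndependent ℚ (Fin.snoc ![(1 : ℝ)] (Real.arctan (liouvilleNumber 10)) : Fin 2 → ℝ) ∧
      polarDeg (Fin.init (Fin.snoc ![(1 : ℝ)] (Real.arctan (liouvilleNumber 10)) : Fin 2 → ℝ)) ≤
        ((1 + 1 : ℕ) : Cardinal) ∧
      ((1 + 1 + 1 : ℕ) : Cardinal) ≤
        polarDeg (Fin.snoc ![(1 : ℝ)] (Real.arctan (liouvilleNumber 10)) : Fin 2 → ℝ) ∧
      SharpRelativeLindemannAt 1 (Fin.snoc ![(1 : ℝ)] (Real.arctan (liouvilleNumber 10)) : Fin 2 → ℝ) :=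
  RootDecomp1BSRLLogLiouville.cell_one_arctan_liouvilleNumber_ten lwMeasure_holds

/-- `(√2 | L₁₀)`: `t ≥ 3`, SRLAt — UNCONDITIONAL. -/
theorem cell_sqrt_two_liouvilleNumber_ten :
    LinearIndependent ℚ (Fin.snoc ![Real.sqrt 2] (liouvilleNumber 10) : Fin 2 → ℝ) ∧
      polarDeg (Fin.init (Fin.snoc ![Real.sqrt 2] (liouvilleNumber 10) : Fin 2 → ℝ)) ≤
        ((1 + 1 : ℕ) : Cardinal) ∧
      ((1 + 1 + 1 : ℕ) : Cardinal) ≤ polarDeg (Fin.snoc ![Real.sqrt 2] (liouvilleNumber 10) : Fin 2 → ℝ) ∧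
      SharpRelativeLindemannAt 1 (Fin.snoc ![Real.sqrt 2] (liouvilleNumber 10) : Fin 2 → ℝ) :=
  RootDecomp1BSRLLogLiouville.cell_sqrt_two_liouvilleNumber_ten lwMeasure_holds

end Summit.Schanuel.Schanuel.Theorems.RootDecomp1BFactDischarge

end
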